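/-
Copyright (c) 2026 the pub-hodgecm-mathlib formalisation cell (harness21).  Prover seat hodgecm-mathlib-K2E3-p03 (g9) (valve hand; LEAD F0P6-plan (g14) BATCH #107 (2)
«(KW1-e∞) → K2E3-p03», line lead K2Liu-p14 (g4) LINE WORD #2 ∕ #5 «GO AS SPEC'D», LH4-p09 (g10) 2026-09-04T23:04:01Z «your file is the two P_Δ-unipotent moves +
`w₀ m(D) w₀⁻¹ ∈ M_Δ` + ONE rw»): Track B «K2-LIT», hLiu418 = stmt-HodgeConjecture-24832, road `K2_Liu`, socket #41, KIND 1, organ (K1b-W), file (KW1-e∞).  2026-09-04.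
-/
import Summits.HodgeConjecture.HodgeConjecture.Theorems.K2LiuKindOneLineWhittakerIwasawa   -- ★ p862865 (LH4-p09 (g10)): `lineWhittaker_iwasawa` (the LINE's Iwasawa reading, `l := Fin 1`); brings ★ (D∞) tube defs, ★ (V-L1) Levi letters, ★ (A∞-0b)
import HarnessLib

/-!
# Crux `HLiu418`, socket #41, KIND 1 ∕ organ (K1b-W), file (KW1-e∞) `K2LiuKindOneLineCornerArchReading`: THE ARCHIMEDEAN READING OF THE CORNER TRANSLATE —
# in the tube frame `U(2,2) ⊃ U(1,1)` (the line on the second index), `f(w₀ n₂(t) · m(D₁) m(U₀) n(B) · ι(g₁) · κ) = ρ(κ) · χ(r₁)‖r₁‖^{2s+2} · (f ∘ ι)(J₁ n₁(t) g₁)`,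
# `f ∘ ι` a LINE Siegel section of parameter `s + ½`; then ★ `lineWhittaker_iwasawa` reads the line Whittaker integral at `g₁ = n₁(b₀) m₁(a,d)`

Cell `hodgecm-mathlib`, crux item hLiu418 = `stmt-HodgeConjecture-24832` (helper lane `--supports stmt-HodgeConjecture-24832 --as helper`, count-neutral); squad K2 ∕ K2Liu,
road `K2_Liu`, socket #41, KIND 1, organ (K1b-W) (line lead K2Liu-p14 (g4); desk F0P2-p11 (g2)); prover K2E3-p03 (g9).  THEOREMS ONLY (no `def`, no `instance`, no notation,
no named-fact hypothesis, no `sorry`).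

THE FRAME (★ (D∞) `K2LiuArchInducedTubeDefs`, ★ (V-L1) `K2LiuArchWhittakerLeviEquivariance`, ★ p862865 `K2LiuKindOneLineWhittakerIwasawa`): `U(J)`, `J = Matrix.J l ℂ`,
`n(x) = fromBlocks 1 x 0 1`, `m(a,d) = fromBlocks a 0 0 d` (`aᴴ d = 1`), `IsArchSiegelSection χ s f : f (p g) = χ(det A_p) ‖det A_p‖^{2s+l} f g`.  The big group is
`l := Fin 2` (`U(2,2)` at a complex place), the LINE is `l := Fin 1` (`J₁ = Matrix.J (Fin 1) ℂ`, `n₁(t) = fromBlocks 1 ((t:ℂ)•1) 0 1`, `m₁(a,d)`), and the CORNER EMBEDDING —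
the archimedean component of Kudla's see-saw chart `blkD(1, ·)` (★ Literature `GRConstruction.blkD`, ★ (T4-α) ∕ ★ (KW1-e) PART 1 ∕ ★ (e2′)) — puts the line on the SECOND index:
  `ι x = fromBlocks !![1,0;0,x₁₁] !![0,0;0,x₁₂] !![0,0;0,x₂₁] !![1,0;0,x₂₂]`  (`x_{ij}` the entries of `x : Matrix (Fin 1 ⊕ Fin 1) (Fin 1 ⊕ Fin 1) ℂ`).
No definition is introduced: every head takes `(ι) (hι : ∀ x, ι x = …)` BY VALUE (the consumer passes `(fun x => …) (fun _ => rfl)`); the corner Weyl element and corner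
unipotents are `w₀ = ι J₁`, `n₂(t) = ι (n₁ t)`, so the corner translate reads `f (ι (J₁ · n₁ t) · g)`.
* §1 THE CORNER ALGEBRA (entrywise): `corner_mul` (`ι(xy) = ι x · ι y`), `corner_conjTranspose`, `J_eq_corner_mul` (`J₂ = ι J₁ · J₀`, `J₀` = `J` on the first index),
  `cornerCompl_comm` (`J₀` commutes with the corner), **`corner_mem`** (`xᴴ J₁ x = J₁ → (ι x)ᴴ J₂ (ι x) = J₂`), `corner_toBlocks₂₁`, `corner_toBlocks₁₁_det`.
* §2 **`isArchSiegelSection_corner`** — for `f ∈ I_w(s, χ)` on `U(2,2)` and ANY `g`, `x ↦ f (ι x · g)` is a LINE Siegel section of `I_w(s + ½, χ)` (the `+n₁∕2` shift of ★ (KW1-e):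
  `‖det A‖^{2s+2} = ‖a‖^{2(s+½)+1}`); **`archScalarSection_corner`** — `archScalarSection k s (ι x) = archScalarSection k (s + ½) x` (`j(ι x, i·1₂) = j(x, i)`).
* §3 THE THREE MOVES of LINE WORD #2, as group identities + the section law (`χ 1 = 1`): **`corner_transl_peel`** (`w₀ n₂(t) · n(b E₁₁ + c E₁₂ + c̄ E₂₁) = q · w₀ n₂(t)` with
  `q ∈ U(J) ∩ P_Δ`, Levi block `!![1,−c;0,1]`: the `w₀`-conjugates of the off-corner translations are UNIPOTENT in `P_Δ`), **`corner_unip_peel`** (`w₀ n₂(t) · m(U₀) = r_t · w₀ n₂(t)`,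
  `U₀ = !![1,u;0,1]`, `r_t ∈ U(J) ∩ P_Δ` with Levi block `!![1,tu;0,1]`: `m(U₀) ∈ N_Q` up to the corner commutator), **`corner_levi_peel`** (`m(diag(r,1), diag(r̄⁻¹,1))` COMMUTES with the
  corner and lies in `M_Δ`: factor `χ(r)‖r‖^{2s+2}` = LINE WORD #2's `σ_{χ,s}(w₀ m(D) w₀⁻¹)` off-corner part).
* §4 **`corner_reading`** — for `g = m(diag(r,1)) · m(U₀) · n(b E₁₁ + c E₁₂ + c̄ E₂₁) · ι g₁ · κ` with the `K`-letter `hκ : ∀ g, f (g κ) = ρ · f g` BY VALUE: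
  `f (ι(J₁ n₁ t) · g) = ρ · χ(r)‖r‖^{2s+2} · f (ι (J₁ · n₁ t · g₁))`; **`corner_lineWhittaker`** (the `dt`-integral against `e^{−2πiμt}`, no integrability needed) and
  **`corner_lineWhittaker_iwasawa`** — at `g₁ = n₁(b₀) · m₁(a,d)` the right side is READ by ★ `lineWhittaker_iwasawa` at parameter `s + ½`:
  `= ρ · χ(r)‖r‖^{2s+2} · e^{2πiμb₀} · χ(d₀₀) · ‖a₀₀‖^{1−2(s+½)} · ∫ f(ι(J₁ n₁ t)) e^{−2πi(‖a₀₀‖²μ)t} dt` — LINE WORD #2's `ρ(κ)·σ(w₀ m(D) w₀⁻¹)·ψ_w(μ b₂₂)·|r₂|^{e(s)}·W⁽¹⁾_{μ r₂ r̄₂}(φ)(1)`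
  with `φ = f ∘ ι` (`= archScalarSection k (s+½)` for the scalar type, §2).  Consumers: LH4-p09 (KW1-d) `harch` by value, LH4-p18 (f).
[Shimura1997, §16, §18.4]; [KudlaRallis1994, §2]; [Kudla1994, §2]; [Bump1997, §1.6].
HONEST LABEL.  Count-neutral helper, closes no socket: `HC_CM` is proved only modulo the 7 printed citations (2 remaining named inputs: hLiu418 =
`stmt-HodgeConjecture-24832`, h413 = `stmt-HodgeConjecture-24833`) until rung 0 closes.  NOT here: the `K_w`-type letter `hκ` (★ (A∞-0) for the scalar types), the
identification of the arch component of `blkD(1,·)` with `ι` (★ (e2′)), the even-`k` line bounds.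
-/

set_option autoImplicit false
set_option linter.dupNamespace false -- the mandated namespace repeats `HodgeConjecture.HodgeConjecture`

noncomputable section

open Complex MeasureTheory Matrix
open scoped ComplexConjugate Matrix

namespace Summit.HodgeConjecture.HodgeConjecture.Cruxes.HLiu418.K2LiuKindOneLineCornerArchReading

open Summit.HodgeConjecture.HodgeConjecture.Cruxes.HLiu418.K2LiuArchInducedTubeDefs
open Summit.HodgeConjecture.HodgeConjecture.Cruxes.HLiu418.K2LiuKindOneLineWhittakerIwasawa (lineWhittaker_iwasawa)

/-! ## §1 The corner algebra -/

section Corner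

variable (ι : Matrix (Fin 1 ⊕ Fin 1) (Fin 1 ⊕ Fin 1) ℂ → Matrix (Fin 2 ⊕ Fin 2) (Fin 2 ⊕ Fin 2) ℂ)
    (hι : ∀ x, ι x = fromBlocks !![1, 0; 0, x (Sum.inl 0) (Sum.inl 0)] !![0, 0; 0, x (Sum.inl 0) (Sum.inr 0)] !![0, 0; 0, x (Sum.inr 0) (Sum.inl 0)] !![1, 0; 0, x (Sum.inr 0) (Sum.inr 0)])

include hι in
/-- **`ι` is multiplicative**: `ι (x y) = ι x · ι y` (the line acts on the second index, the first index is untouched). [cite: Kudla1994, §2] -/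
theorem corner_mul (x y : Matrix (Fin 1 ⊕ Fin 1) (Fin 1 ⊕ Fin 1) ℂ) : ι (x * y) = ι x * ι y := by
  rw [hι, hι, hι]
  ext i j
  rcases i with i | i <;> rcases j with j | j <;> fin_cases i <;> fin_cases j <;>
    simp [Matrix.mul_apply, Fintype.sum_sum_type, Fin.sum_univ_two, fromBlocks]

include hι in
/-- `ι` commutes with the conjugate transpose. [folklore] -/
theorem corner_conjTranspose (x : Matrix (Fin 1 ⊕ Fin 1) (Fin 1 ⊕ Fin 1) ℂ) : (ι x)ᴴ = ι xᴴ := by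
  rw [hι, hι]
  ext i j
  rcases i with i | i <;> rcases j with j | j <;> fin_cases i <;> fin_cases j <;>
    simp [fromBlocks, conjTranspose_apply]

include hι in
/-- **`J₂ = ι J₁ · J₀`** with `J₀ = J` on the FIRST index (identity on the corner): the Weyl element of `U(2,2)` splits along the two indices. [cite: Shimura1997, §5.1] -/
theorem J_eq_corner_mul : Matrix.J (Fin 2) ℂ = ι (Matrix.J (Fin 1) ℂ) * fromBlocks !![0, 0; 0, 1] !![-1, 0; 0, 0] !![1, 0; 0, 0] !![0, 0; 0, 1] := by
  rw [hι, Matrix.J, Matrix.J]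
  ext i j
  rcases i with i | i <;> rcases j with j | j <;> fin_cases i <;> fin_cases j <;>
    simp [Matrix.mul_apply, Fintype.sum_sum_type, Fin.sum_univ_two, fromBlocks]

include hι in
/-- `J₀` (the Weyl element of the first index) COMMUTES with the corner. [cite: Shimura1997, §5.1] -/
theorem cornerCompl_comm (x : Matrix (Fin 1 ⊕ Fin 1) (Fin 1 ⊕ Fin 1) ℂ) : fromBlocks !![0, 0; 0, 1] !![-1, 0; 0, 0] !![1, 0; 0, 0] !![0, 0; 0, 1] * ι x = ι x * fromBlocks !![0, 0; 0, 1] !![-1, 0; 0, 0] !![1, 0; 0, 0] !![0, 0; 0, 1] := by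
  rw [hι]
  ext i j
  rcases i with i | i <;> rcases j with j | j <;> fin_cases i <;> fin_cases j <;>
    simp [Matrix.mul_apply, Fintype.sum_sum_type, Fin.sum_univ_two, fromBlocks]

include hι in
/-- **`ι` maps `U(J₁)` into `U(J₂)`**: `xᴴ J₁ x = J₁ ⟹ (ι x)ᴴ J₂ (ι x) = J₂` (`J₂ = ι J₁ · J₀`, `J₀` central for the corner, `ι` a `*`-homomorphism). [cite: Kudla1994, §2] -/
theorem corner_mem {x : Matrix (Fin 1 ⊕ Fin 1) (Fin 1 ⊕ Fin 1) ℂ} (hx : xᴴ * Matrix.J (Fin 1) ℂ * x = Matrix.J (Fin 1) ℂ) : (ι x)ᴴ * Matrix.J (Fin 2) ℂ * ι x = Matrix.J (Fin 2) ℂ := by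
  rw [J_eq_corner_mul ι hι, corner_conjTranspose ι hι, Matrix.mul_assoc, Matrix.mul_assoc, cornerCompl_comm ι hι, ← Matrix.mul_assoc,
    ← Matrix.mul_assoc, ← corner_mul ι hι, ← corner_mul ι hι, hx]

include hι in
/-- the lower-left block of `ι x` is `!![0,0;0,x₂₁]`; it vanishes iff `x₂₁ = 0`. [folklore] -/
theorem corner_toBlocks₂₁ (x : Matrix (Fin 1 ⊕ Fin 1) (Fin 1 ⊕ Fin 1) ℂ) : (ι x).toBlocks₂₁ = !![0, 0; 0, x (Sum.inr 0) (Sum.inl 0)] := by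
  rw [hι, toBlocks_fromBlocks₂₁]

include hι in
/-- the Levi block of `ι x` is `!![1,0;0,x₁₁]`, of determinant `x₁₁ = det x₁₁` (1×1). [folklore] -/
theorem corner_toBlocks₁₁_det (x : Matrix (Fin 1 ⊕ Fin 1) (Fin 1 ⊕ Fin 1) ℂ) : (ι x).toBlocks₁₁.det = x.toBlocks₁₁.det := by
  rw [hι, toBlocks_fromBlocks₁₁, Matrix.det_fin_two_of, Matrix.det_fin_one]
  simp [toBlocks₁₁]

include hι in
/-- a line element of the Siegel parabolic (`x₂₁ = 0`) maps to an element of the big Siegel parabolic. [folklore] -/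
theorem corner_toBlocks₂₁_eq_zero {x : Matrix (Fin 1 ⊕ Fin 1) (Fin 1 ⊕ Fin 1) ℂ} (hx : x.toBlocks₂₁ = 0) : (ι x).toBlocks₂₁ = 0 := by
  have h0 : x (Sum.inr 0) (Sum.inl 0) = 0 := by
    have := congrFun (congrFun hx 0) 0
    simpa [toBlocks₂₁] using this
  rw [corner_toBlocks₂₁ ι hι, h0]
  ext i j
  fin_cases i <;> fin_cases j <;> simp

end Corner

/-! ## §2 The corner pullback is a line Siegel section of parameter `s + ½` -/

section Pullback

variable (ι : Matrix (Fin 1 ⊕ Fin 1) (Fin 1 ⊕ Fin 1) ℂ → Matrix (Fin 2 ⊕ Fin 2) (Fin 2 ⊕ Fin 2) ℂ)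
    (hι : ∀ x, ι x = fromBlocks !![1, 0; 0, x (Sum.inl 0) (Sum.inl 0)] !![0, 0; 0, x (Sum.inl 0) (Sum.inr 0)] !![0, 0; 0, x (Sum.inr 0) (Sum.inl 0)] !![1, 0; 0, x (Sum.inr 0) (Sum.inr 0)])

include hι in
/-- **THE CORNER PULLBACK IS A LINE SIEGEL SECTION OF `I_w(s + ½, χ)`**: for `f ∈ I_w(s, χ)` on `U(2,2)` (tube frame) and ANY `g`, `x ↦ f (ι x · g)` satisfies the line's
parabolic law with `‖a‖^{2(s+½)+1} = ‖det diag(1,a)‖^{2s+2}` — the archimedean twin of ★ (KW1-e) `isSiegelDeltaSection_cornerTranslate` (`+ n₁∕2`). [cite: KudlaRallis1994, §2]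
[cite: Kudla1994, §2, Thm. 3.1] -/
theorem isArchSiegelSection_corner {χ : ℂ → ℂ} {s : ℂ} {f : Matrix (Fin 2 ⊕ Fin 2) (Fin 2 ⊕ Fin 2) ℂ → ℂ} (hf : IsArchSiegelSection χ s f) (g : Matrix (Fin 2 ⊕ Fin 2) (Fin 2 ⊕ Fin 2) ℂ) :
    IsArchSiegelSection χ (s + 1 / 2) (fun x => f (ι x * g)) := by
  intro p y hP hp
  simp only
  rw [corner_mul ι hι, Matrix.mul_assoc, hf (ι p) (ι y * g) (corner_mem ι hι hP) (corner_toBlocks₂₁_eq_zero ι hι hp),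
    corner_toBlocks₁₁_det ι hι]
  congr 2
  simp only [Fintype.card_fin]
  push_cast
  ring

include hι in
/-- **THE SCALAR TYPE RESTRICTS TO THE SCALAR TYPE**: `archScalarSection k s (ι x) = archScalarSection k (s + ½) x` (`j(ι x, i·1₂) = det diag(1, x₂₁ i + x₂₂) = j(x, i)` and
`k − 2s − 2 = k − 2(s+½) − 1`). [cite: Shimura1997, §16.4] -/
theorem archScalarSection_corner (k : ℤ) (s : ℂ) (x : Matrix (Fin 1 ⊕ Fin 1) (Fin 1 ⊕ Fin 1) ℂ) :
    archScalarSection k s (ι x) = archScalarSection k (s + 1 / 2) x := by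
  have hden : (Literature.NumberTheory.ModularForms.SiegelUpperHalfSpace.denom (ι x) (I • (1 : Matrix (Fin 2) (Fin 2) ℂ))).det =
      (Literature.NumberTheory.ModularForms.SiegelUpperHalfSpace.denom x (I • (1 : Matrix (Fin 1) (Fin 1) ℂ))).det := by
    rw [Literature.NumberTheory.ModularForms.SiegelUpperHalfSpace.denom_def, Literature.NumberTheory.ModularForms.SiegelUpperHalfSpace.denom_def, hι,
      toBlocks_fromBlocks₂₁, toBlocks_fromBlocks₂₂, Matrix.det_fin_one, Matrix.det_fin_two]
    simp [toBlocks₂₁, toBlocks₂₂, Matrix.add_apply]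
  rw [archScalarSection_apply, archScalarSection_apply, hden]
  congr 2
  simp only [Fintype.card_fin]
  push_cast
  ring

end Pullback

/-! ## §3 The three moves: off-corner unipotents, the `N_Q`-unipotent, the off-corner Levi -/

section Moves

variable (ι : Matrix (Fin 1 ⊕ Fin 1) (Fin 1 ⊕ Fin 1) ℂ → Matrix (Fin 2 ⊕ Fin 2) (Fin 2 ⊕ Fin 2) ℂ)
    (hι : ∀ x, ι x = fromBlocks !![1, 0; 0, x (Sum.inl 0) (Sum.inl 0)] !![0, 0; 0, x (Sum.inl 0) (Sum.inr 0)] !![0, 0; 0, x (Sum.inr 0) (Sum.inl 0)] !![1, 0; 0, x (Sum.inr 0) (Sum.inr 0)])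

include hι in
/-- (M1)+(M2) as a group identity: **`w₀ n₂(t) · n(b E₁₁ + c E₁₂ + c̄ E₂₁) = q · w₀ n₂(t)`** with `q = fromBlocks !![1,−c;0,1] !![b,0;0,0] 0 !![1,0;c̄,1]` — the
`w₀`-conjugate of the off-corner part of a translation is a UNIPOTENT element of `P_Δ`. [cite: Shimura1997, §5.1] -/
theorem corner_J_transl_mul_transl (t b : ℝ) (c : ℂ) :
    ι (Matrix.J (Fin 1) ℂ * fromBlocks 1 ((t : ℂ) • (1 : Matrix (Fin 1) (Fin 1) ℂ)) 0 1) * fromBlocks 1 !![((b : ℝ) : ℂ), c; conj c, 0] 0 1 = fromBlocks !![1, -c; 0, 1] !![((b : ℝ) : ℂ), 0; 0, 0] 0 !![1, 0; conj c, 1] * ι (Matrix.J (Fin 1) ℂ * fromBlocks 1 ((t : ℂ) • (1 : Matrix (Fin 1) (Fin 1) ℂ)) 0 1) := by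
  rw [hι, Matrix.J]
  ext i j
  rcases i with i | i <;> rcases j with j | j <;> fin_cases i <;> fin_cases j <;>
    simp [Matrix.mul_apply, Fintype.sum_sum_type, Fin.sum_univ_two, fromBlocks]

/-- `q` lies in `U(J)` (`b` real). [cite: Shimura1997, §5.1] -/
theorem translPeel_mem (b : ℝ) (c : ℂ) :
    (fromBlocks !![1, -c; 0, 1] !![((b : ℝ) : ℂ), 0; 0, 0] 0 !![1, 0; conj c, 1] : Matrix (Fin 2 ⊕ Fin 2) (Fin 2 ⊕ Fin 2) ℂ)ᴴ * Matrix.J (Fin 2) ℂ * fromBlocks !![1, -c; 0, 1] !![((b : ℝ) : ℂ), 0; 0, 0] 0 !![1, 0; conj c, 1] = Matrix.J (Fin 2) ℂ := by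
  rw [Matrix.J]
  ext i j
  rcases i with i | i <;> rcases j with j | j <;> fin_cases i <;> fin_cases j <;>
    simp [Matrix.mul_apply, Fintype.sum_sum_type, Fin.sum_univ_two, fromBlocks, conjTranspose_apply]

include hι in
/-- **(M1)+(M2) THE OFF-CORNER TRANSLATIONS DIE**: `f (w₀ n₂(t) · n(b E₁₁ + c E₁₂ + c̄ E₂₁) · Y) = f (w₀ n₂(t) · Y)` for a Siegel section `f` (`χ 1 = 1`): the peeled factor `q` is
in `U(J) ∩ P_Δ` with Levi block `!![1,−c;0,1]` of determinant `1`. [cite: Shimura1997, §16] [cite: KudlaRallis1994, §2] -/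
theorem corner_transl_peel {χ : ℂ → ℂ} {s : ℂ} {f : Matrix (Fin 2 ⊕ Fin 2) (Fin 2 ⊕ Fin 2) ℂ → ℂ} (hf : IsArchSiegelSection χ s f) (hχ : χ 1 = 1)
    (t b : ℝ) (c : ℂ) (Y : Matrix (Fin 2 ⊕ Fin 2) (Fin 2 ⊕ Fin 2) ℂ) :
    f (ι (Matrix.J (Fin 1) ℂ * fromBlocks 1 ((t : ℂ) • (1 : Matrix (Fin 1) (Fin 1) ℂ)) 0 1) * (fromBlocks 1 !![((b : ℝ) : ℂ), c; conj c, 0] 0 1 * Y)) = f (ι (Matrix.J (Fin 1) ℂ * fromBlocks 1 ((t : ℂ) • (1 : Matrix (Fin 1) (Fin 1) ℂ)) 0 1) * Y) := by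
  rw [← Matrix.mul_assoc, corner_J_transl_mul_transl ι hι, Matrix.mul_assoc,
    hf _ _ (translPeel_mem b c) (toBlocks_fromBlocks₂₁ _ _ _ _), toBlocks_fromBlocks₁₁, Matrix.det_fin_two_of]
  simp [hχ]

include hι in
/-- (M3) as a group identity: **`w₀ n₂(t) · m(U₀) = r_t · w₀ n₂(t)`**, `U₀ = !![1,u;0,1]`, `m(U₀) = fromBlocks U₀ 0 0 U₀⁻ᴴ`, with
`r_t = fromBlocks !![1,tu;0,1] !![0,u;ū,0] 0 !![1,0;−tū,1]` — `w₀ m(U₀) w₀⁻¹ ∈ N_Δ` and the corner commutator `n(t(|u|²E₁₁ − uE₁₂ − ūE₂₁))` conjugate into `P_Δ`.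
[cite: Shimura1997, §5.1] -/
theorem corner_J_transl_mul_unip (t : ℝ) (u : ℂ) :
    ι (Matrix.J (Fin 1) ℂ * fromBlocks 1 ((t : ℂ) • (1 : Matrix (Fin 1) (Fin 1) ℂ)) 0 1) * fromBlocks !![1, u; 0, 1] 0 0 !![1, 0; -conj u, 1] = fromBlocks !![1, (t : ℂ) * u; 0, 1] !![0, u; conj u, 0] 0 !![1, 0; -((t : ℂ) * conj u), 1] * ι (Matrix.J (Fin 1) ℂ * fromBlocks 1 ((t : ℂ) • (1 : Matrix (Fin 1) (Fin 1) ℂ)) 0 1) := by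
  rw [hι, Matrix.J]
  ext i j
  rcases i with i | i <;> rcases j with j | j <;> fin_cases i <;> fin_cases j <;>
    simp [Matrix.mul_apply, Fintype.sum_sum_type, Fin.sum_univ_two, fromBlocks]
  ring

/-- `r_t` lies in `U(J)`. [cite: Shimura1997, §5.1] -/
theorem unipPeel_mem (t : ℝ) (u : ℂ) :
    (fromBlocks !![1, (t : ℂ) * u; 0, 1] !![0, u; conj u, 0] 0 !![1, 0; -((t : ℂ) * conj u), 1] : Matrix (Fin 2 ⊕ Fin 2) (Fin 2 ⊕ Fin 2) ℂ)ᴴ * Matrix.J (Fin 2) ℂ * fromBlocks !![1, (t : ℂ) * u; 0, 1] !![0, u; conj u, 0] 0 !![1, 0; -((t : ℂ) * conj u), 1] = Matrix.J (Fin 2) ℂ := by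
  rw [Matrix.J]
  ext i j
  rcases i with i | i <;> rcases j with j | j <;> fin_cases i <;> fin_cases j <;>
    simp [Matrix.mul_apply, Fintype.sum_sum_type, Fin.sum_univ_two, fromBlocks, conjTranspose_apply]
  ring

include hι in
/-- **(M3) THE `N_Q`-UNIPOTENT DIES**: `f (w₀ n₂(t) · m(U₀) · Y) = f (w₀ n₂(t) · Y)` (`χ 1 = 1`; `r_t ∈ U(J) ∩ P_Δ`, Levi block `!![1,tu;0,1]`). [cite: Shimura1997, §16]
[cite: KudlaRallis1994, §2] -/
theorem corner_unip_peel {χ : ℂ → ℂ} {s : ℂ} {f : Matrix (Fin 2 ⊕ Fin 2) (Fin 2 ⊕ Fin 2) ℂ → ℂ} (hf : IsArchSiegelSection χ s f) (hχ : χ 1 = 1)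
    (t : ℝ) (u : ℂ) (Y : Matrix (Fin 2 ⊕ Fin 2) (Fin 2 ⊕ Fin 2) ℂ) :
    f (ι (Matrix.J (Fin 1) ℂ * fromBlocks 1 ((t : ℂ) • (1 : Matrix (Fin 1) (Fin 1) ℂ)) 0 1) * (fromBlocks !![1, u; 0, 1] 0 0 !![1, 0; -conj u, 1] * Y)) = f (ι (Matrix.J (Fin 1) ℂ * fromBlocks 1 ((t : ℂ) • (1 : Matrix (Fin 1) (Fin 1) ℂ)) 0 1) * Y) := by
  rw [← Matrix.mul_assoc, corner_J_transl_mul_unip ι hι, Matrix.mul_assoc,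
    hf _ _ (unipPeel_mem t u) (toBlocks_fromBlocks₂₁ _ _ _ _), toBlocks_fromBlocks₁₁, Matrix.det_fin_two_of]
  simp [hχ]

include hι in
/-- (M4) as a group identity: **the off-corner Levi element COMMUTES with the corner**: `w₀ n₂(t) · m(diag(r,1), diag(r̄⁻¹,1)) = m(diag(r,1), diag(r̄⁻¹,1)) · w₀ n₂(t)`.
[cite: Shimura1997, §5.1] -/
theorem corner_J_transl_mul_levi (t : ℝ) (r : ℂ) :
    ι (Matrix.J (Fin 1) ℂ * fromBlocks 1 ((t : ℂ) • (1 : Matrix (Fin 1) (Fin 1) ℂ)) 0 1) * fromBlocks !![r, 0; 0, 1] 0 0 !![(conj r)⁻¹, 0; 0, 1] = fromBlocks !![r, 0; 0, 1] 0 0 !![(conj r)⁻¹, 0; 0, 1] * ι (Matrix.J (Fin 1) ℂ * fromBlocks 1 ((t : ℂ) • (1 : Matrix (Fin 1) (Fin 1) ℂ)) 0 1) := by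
  rw [hι, Matrix.J]
  ext i j
  rcases i with i | i <;> rcases j with j | j <;> fin_cases i <;> fin_cases j <;>
    simp [Matrix.mul_apply, Fintype.sum_sum_type, Fin.sum_univ_two, fromBlocks]

/-- `m(diag(r,1), diag(r̄⁻¹,1))` lies in `U(J)` for `r ≠ 0`. [cite: Shimura1997, §5.1] -/
theorem leviPeel_mem {r : ℂ} (hr : r ≠ 0) :
    (fromBlocks !![r, 0; 0, 1] 0 0 !![(conj r)⁻¹, 0; 0, 1] : Matrix (Fin 2 ⊕ Fin 2) (Fin 2 ⊕ Fin 2) ℂ)ᴴ * Matrix.J (Fin 2) ℂ * fromBlocks !![r, 0; 0, 1] 0 0 !![(conj r)⁻¹, 0; 0, 1] = Matrix.J (Fin 2) ℂ := by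
  have hc : conj r ≠ 0 := (map_ne_zero _).2 hr
  rw [Matrix.J]
  ext i j
  rcases i with i | i <;> rcases j with j | j <;> fin_cases i <;> fin_cases j <;>
    simp [Matrix.mul_apply, Fintype.sum_sum_type, Fin.sum_univ_two, fromBlocks, conjTranspose_apply, hc, inv_mul_cancel₀ hr]

include hι in
/-- **(M4) THE OFF-CORNER LEVI IS A SCALAR**: `f (w₀ n₂(t) · m(diag(r,1), diag(r̄⁻¹,1)) · Y) = χ(r) · ‖r‖^{2s+2} · f (w₀ n₂(t) · Y)` (`r ≠ 0`) — the off-corner half of LINE WORD #2's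
`σ_{χ,s}(w₀ m(D) w₀⁻¹)`; the corner half `r₂` stays inside `g₁` for ★ `lineWhittaker_iwasawa`. [cite: Shimura1997, §16] [cite: KudlaRallis1994, §2] -/
theorem corner_levi_peel {χ : ℂ → ℂ} {s : ℂ} {f : Matrix (Fin 2 ⊕ Fin 2) (Fin 2 ⊕ Fin 2) ℂ → ℂ} (hf : IsArchSiegelSection χ s f) {r : ℂ} (hr : r ≠ 0)
    (t : ℝ) (Y : Matrix (Fin 2 ⊕ Fin 2) (Fin 2 ⊕ Fin 2) ℂ) :
    f (ι (Matrix.J (Fin 1) ℂ * fromBlocks 1 ((t : ℂ) • (1 : Matrix (Fin 1) (Fin 1) ℂ)) 0 1) * (fromBlocks !![r, 0; 0, 1] 0 0 !![(conj r)⁻¹, 0; 0, 1] * Y)) = χ r * ((‖r‖ : ℝ) : ℂ) ^ (2 * s + 2) * f (ι (Matrix.J (Fin 1) ℂ * fromBlocks 1 ((t : ℂ) • (1 : Matrix (Fin 1) (Fin 1) ℂ)) 0 1) * Y) := by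
  rw [← Matrix.mul_assoc, corner_J_transl_mul_levi ι hι, Matrix.mul_assoc,
    hf _ _ (leviPeel_mem hr) (toBlocks_fromBlocks₂₁ _ _ _ _), toBlocks_fromBlocks₁₁, Matrix.det_fin_two_of]
  simp only [Fintype.card_fin, mul_one, mul_zero, sub_zero, Nat.cast_ofNat]

end Moves

/-! ## §4 The corner reading -/

section Reading

variable (ι : Matrix (Fin 1 ⊕ Fin 1) (Fin 1 ⊕ Fin 1) ℂ → Matrix (Fin 2 ⊕ Fin 2) (Fin 2 ⊕ Fin 2) ℂ)
    (hι : ∀ x, ι x = fromBlocks !![1, 0; 0, x (Sum.inl 0) (Sum.inl 0)] !![0, 0; 0, x (Sum.inl 0) (Sum.inr 0)] !![0, 0; 0, x (Sum.inr 0) (Sum.inl 0)] !![1, 0; 0, x (Sum.inr 0) (Sum.inr 0)])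

include hι in
/-- **THE ARCHIMEDEAN READING OF THE CORNER TRANSLATE (pointwise).**  Big group `U(2,2)` in the tube frame, `f ∈ I_w(s, χ)` a Siegel section with `χ 1 = 1` and a
right-`κ` letter `f (g κ) = ρ · f g` (scalar `K_w`-type BY VALUE); `g = m(diag(r,1), diag(r̄⁻¹,1)) · m(U₀) · n(b E₁₁ + c E₁₂ + c̄ E₂₁) · ι g₁ · κ` (`r ≠ 0`, `U₀ = !![1,u;0,1]`,
`g₁` the CORNER component).  THEN `f (w₀ n₂(t) · g) = ρ · χ(r)‖r‖^{2s+2} · f (ι (J₁ · n₁(t) · g₁))` — §3's three moves and `ι`'s multiplicativity.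
[cite: Shimura1997, §16, §18.4] [cite: KudlaRallis1994, §2] [cite: Kudla1994, §2] -/
theorem corner_reading {χ : ℂ → ℂ} {s : ℂ} {f : Matrix (Fin 2 ⊕ Fin 2) (Fin 2 ⊕ Fin 2) ℂ → ℂ} (hf : IsArchSiegelSection χ s f) (hχ : χ 1 = 1)
    {r : ℂ} (hr : r ≠ 0) (u c : ℂ) (b : ℝ) (g₁ : Matrix (Fin 1 ⊕ Fin 1) (Fin 1 ⊕ Fin 1) ℂ) {κ : Matrix (Fin 2 ⊕ Fin 2) (Fin 2 ⊕ Fin 2) ℂ} {ρ : ℂ} (hκ : ∀ g, f (g * κ) = ρ * f g) (t : ℝ) :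
    f (ι (Matrix.J (Fin 1) ℂ * fromBlocks 1 ((t : ℂ) • (1 : Matrix (Fin 1) (Fin 1) ℂ)) 0 1) * (fromBlocks !![r, 0; 0, 1] 0 0 !![(conj r)⁻¹, 0; 0, 1] * fromBlocks !![1, u; 0, 1] 0 0 !![1, 0; -conj u, 1] * fromBlocks 1 !![((b : ℝ) : ℂ), c; conj c, 0] 0 1 * ι g₁ * κ)) =
      ρ * (χ r * ((‖r‖ : ℝ) : ℂ) ^ (2 * s + 2)) * f (ι (Matrix.J (Fin 1) ℂ * fromBlocks 1 ((t : ℂ) • (1 : Matrix (Fin 1) (Fin 1) ℂ)) 0 1 * g₁)) := by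
  rw [show ι (Matrix.J (Fin 1) ℂ * fromBlocks 1 ((t : ℂ) • (1 : Matrix (Fin 1) (Fin 1) ℂ)) 0 1) * (fromBlocks !![r, 0; 0, 1] 0 0 !![(conj r)⁻¹, 0; 0, 1] * fromBlocks !![1, u; 0, 1] 0 0 !![1, 0; -conj u, 1] * fromBlocks 1 !![((b : ℝ) : ℂ), c; conj c, 0] 0 1 * ι g₁ * κ) =
      ι (Matrix.J (Fin 1) ℂ * fromBlocks 1 ((t : ℂ) • (1 : Matrix (Fin 1) (Fin 1) ℂ)) 0 1) * (fromBlocks !![r, 0; 0, 1] 0 0 !![(conj r)⁻¹, 0; 0, 1] * (fromBlocks !![1, u; 0, 1] 0 0 !![1, 0; -conj u, 1] * (fromBlocks 1 !![((b : ℝ) : ℂ), c; conj c, 0] 0 1 * ι g₁))) * κ by simp only [Matrix.mul_assoc],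
    hκ, corner_levi_peel ι hι hf hr, corner_unip_peel ι hι hf hχ, corner_transl_peel ι hι hf hχ, ← corner_mul ι hι]
  ring

include hι in
/-- **THE CORNER LINE-WHITTAKER INTEGRAL** (no integrability hypothesis: both sides vanish together otherwise): integrating `corner_reading` against `e^{−2πiμt}`,
`∫ f (w₀ n₂(t) · g) e^{−2πiμt} dt = ρ · χ(r)‖r‖^{2s+2} · ∫ (f ∘ ι)(J₁ n₁(t) g₁) e^{−2πiμt} dt` — the right side is the LINE Whittaker integral of the line section `f ∘ ι`
(§2) at the corner component `g₁`. [cite: Shimura1997, §16, §18.4] [cite: KudlaRallis1994, §2] -/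
theorem corner_lineWhittaker {χ : ℂ → ℂ} {s : ℂ} {f : Matrix (Fin 2 ⊕ Fin 2) (Fin 2 ⊕ Fin 2) ℂ → ℂ} (hf : IsArchSiegelSection χ s f) (hχ : χ 1 = 1)
    {r : ℂ} (hr : r ≠ 0) (u c : ℂ) (b : ℝ) (g₁ : Matrix (Fin 1 ⊕ Fin 1) (Fin 1 ⊕ Fin 1) ℂ) {κ : Matrix (Fin 2 ⊕ Fin 2) (Fin 2 ⊕ Fin 2) ℂ} {ρ : ℂ} (hκ : ∀ g, f (g * κ) = ρ * f g) (μ : ℝ) :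
    ∫ t : ℝ, f (ι (Matrix.J (Fin 1) ℂ * fromBlocks 1 ((t : ℂ) • (1 : Matrix (Fin 1) (Fin 1) ℂ)) 0 1) * (fromBlocks !![r, 0; 0, 1] 0 0 !![(conj r)⁻¹, 0; 0, 1] * fromBlocks !![1, u; 0, 1] 0 0 !![1, 0; -conj u, 1] * fromBlocks 1 !![((b : ℝ) : ℂ), c; conj c, 0] 0 1 * ι g₁ * κ)) * Complex.exp (-(2 * Real.pi * I * μ * t)) =
      ρ * (χ r * ((‖r‖ : ℝ) : ℂ) ^ (2 * s + 2)) *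
        ∫ t : ℝ, f (ι (Matrix.J (Fin 1) ℂ * fromBlocks 1 ((t : ℂ) • (1 : Matrix (Fin 1) (Fin 1) ℂ)) 0 1 * g₁)) * Complex.exp (-(2 * Real.pi * I * μ * t)) := by
  rw [← integral_const_mul]
  refine integral_congr_ae (Filter.Eventually.of_forall fun t => ?_)
  simp only
  rw [corner_reading ι hι hf hχ hr u c b g₁ hκ t]
  ring

include hι in
/-- **THE CORNER READING AT THE IWASAWA POINT `g₁ = n₁(b₀) · m₁(a,d)`** (★ p862865 `lineWhittaker_iwasawa` at parameter `s + ½` for the line section `f ∘ ι`):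
`∫ f (w₀ n₂(t) · g) e^{−2πiμt} dt = ρ · χ(r)‖r‖^{2s+2} · (e^{2πiμb₀} · χ(d₀₀) · ‖a₀₀‖^{1−2(s+½)}) · ∫ f (ι (J₁ n₁(t))) e^{−2πi(‖a₀₀‖²μ)t} dt` — LINE WORD #2's
`ρ(κ) · σ_{χ,s}(w₀ m(D) w₀⁻¹) · ψ_w(μ b₂₂) · |r₂|^{e(s)} · W⁽¹⁾_{μ r₂ r̄₂}(φ)(1)` with `φ = f ∘ ι`. [cite: Shimura1997, §16, §18.4] [cite: KudlaRallis1994, §2] [cite: Bump1997, §1.6] -/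
theorem corner_lineWhittaker_iwasawa {χ : ℂ → ℂ} {s : ℂ} {f : Matrix (Fin 2 ⊕ Fin 2) (Fin 2 ⊕ Fin 2) ℂ → ℂ} (hf : IsArchSiegelSection χ s f) (hχ : χ 1 = 1)
    {r : ℂ} (hr : r ≠ 0) (u c : ℂ) (b : ℝ) {a d : Matrix (Fin 1) (Fin 1) ℂ} (had : aᴴ * d = 1) (b₀ : ℝ) {κ : Matrix (Fin 2 ⊕ Fin 2) (Fin 2 ⊕ Fin 2) ℂ} {ρ : ℂ} (hκ : ∀ g, f (g * κ) = ρ * f g) (μ : ℝ) :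
    ∫ t : ℝ, f (ι (Matrix.J (Fin 1) ℂ * fromBlocks 1 ((t : ℂ) • (1 : Matrix (Fin 1) (Fin 1) ℂ)) 0 1) * (fromBlocks !![r, 0; 0, 1] 0 0 !![(conj r)⁻¹, 0; 0, 1] * fromBlocks !![1, u; 0, 1] 0 0 !![1, 0; -conj u, 1] * fromBlocks 1 !![((b : ℝ) : ℂ), c; conj c, 0] 0 1 *
        ι (fromBlocks 1 ((b₀ : ℂ) • (1 : Matrix (Fin 1) (Fin 1) ℂ)) 0 1 * fromBlocks a 0 0 d) * κ)) * Complex.exp (-(2 * Real.pi * I * μ * t)) =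
      ρ * (χ r * ((‖r‖ : ℝ) : ℂ) ^ (2 * s + 2)) *
        (Complex.exp (2 * Real.pi * I * μ * b₀) * (χ (d 0 0) * ((‖a 0 0‖ : ℝ) : ℂ) ^ (1 - 2 * (s + 1 / 2))) *
          ∫ t : ℝ, f (ι (Matrix.J (Fin 1) ℂ * fromBlocks 1 ((t : ℂ) • (1 : Matrix (Fin 1) (Fin 1) ℂ)) 0 1)) * Complex.exp (-(2 * Real.pi * I * ((‖a 0 0‖ ^ 2 * μ : ℝ) : ℂ) * t))) := by
  have hφ : IsArchSiegelSection χ (s + 1 / 2) (fun x => f (ι x)) := by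
    have h := isArchSiegelSection_corner ι hι hf 1
    simp only [Matrix.mul_one] at h
    exact h
  rw [corner_lineWhittaker ι hι hf hχ hr u c b _ hκ μ]
  congr 1
  have key := lineWhittaker_iwasawa hφ had b₀ μ
  simp only [Matrix.mul_assoc] at key ⊢
  exact key

end Reading

end Summit.HodgeConjecture.HodgeConjecture.Cruxes.HLiu418.K2LiuKindOneLineCornerArchReading

end
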